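/-
Copyright: the b2b-balaban cell (near-miss cell 7), T⁴-continuum CRUX team (coordinator ruling e34b3e0c item (2)),
seat t4-ne7b-formalise-leaf-05 (gen 67). Released under the licence of the surrounding project.
-/
import Mathlib.Analysis.SpecificLimits.Basic
import Summits.QuantumFields.BalabanUV.T4Continuum.Spine.NE7b.ScreeningGrowthLemma

/-!
# The growth lemma S4 of R-SI, sequel: a double exponential beats every geometric bound
# (estimate NE7b, `t4/ROUTES-NE7b.md` v12, block «WHAT CHANGED v11.3 → v12» item (3), step S4 [GROWTH] — its last clause —
# and the growth proviso of corollary LV2⁺)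

Sequel to `…Spine.NE7b.ScreeningGrowthLemma`, which proves the dynamics of S4 up to the explicit double-exponential
lower bound `dexp_lower_explicit : (Cb⁴/ε₀³)·2^{(4/3)^j} ≤ E (k₁ + j)`, `k₁ := ⌈Ca²⌉₊ + ⌈2·Cb⁴/ε₀⁴⌉₊`.
S4's last clause reads «for every `Λ ≥ 2`, `E_* ≥ ε₀` there is an explicit `k*` with `E_k > E_*·Λ^k` for all `k ≥ k*` —
the lower bound is eventually double-exponential in `k`, so it beats every geometric bound», and corollary LV2⁺ uses the
growth in the form «no … local minimiser … has `∫_{B_R}|F_A|² ≤ exp(R^{1/5})` for all large `R`» along `R = 4^k r₀`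
(note `4^{1/5} < 4/3 < 4^{1/4}`: the exponent `1/5` is what the iteration base `4/3` affords).

THIS FILE PROVES (namespace `…NE7b.ScreeningGrowth`; standing hypothesis `h` = the conjunction of the prequel):
* `quad_le_fourThirds_pow` — second-order Bernoulli: `1 + j/3 + j(j−1)/18 ≤ (4/3)^j` (hypothesis-free);
* `geometric_lt_dexp` — EXPLICIT domination (hypothesis-free): for `c₀ > 0`, `L ≥ 1` and every
  `j ≥ ⌈36·(log L + |log c₀| + 1)/log 2⌉₊ + 2`, `c₀·L^j < 2^{(4/3)^j}`;
* `eventually_gt_geometric` — S4's HEADLINE: for every `A`, `Λ` there is `K` (explicitly `k₁ + J`, `J` from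
  `geometric_lt_dexp` at `c₀ := (|A|+1)(|Λ|+1)^{k₁}ε₀³/Cb⁴`, `L := |Λ|+1`) with `A·Λ^k < E k` for all `k ≥ K`;
* `eventually_gt_exp_pow` — LV2⁺'s form: for `0 ≤ θ < 4/3` and every `a`, `exp(a·θ^k) < E k` for all large `k`
  (qualitative index, from the limits `(θ/(4/3))^j → 0` and `(4/3)^j → ∞`);
* `four_rpow_fifth_lt` — `4^{1/5} < 4/3`; `eventually_gt_exp_radius_fifth` — for `r₀ ≥ 0`, eventually
  `exp((4^k·r₀)^{1/5}) < E k` (`(4^k r₀)^{1/5} = r₀^{1/5}·(4^{1/5})^k`).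

HONEST FRAMING. Law-free real analysis about one real sequence; nothing about S1–S3, S6, (★), ε-regularity or gauge
fields; nothing of [Bałaban 1983–89] read, asserted or cited. R-SI stays «rank 3 CANDIDATE, 0 seats, unfunded, price
HIGH»; C-RH° stays KILL PROPOSED 2026-08-28 with the author's concurrence; S4 being kernel-checked changes neither booking
(S4 was flagged [NEW-elementary, K-typable]; its cash value for NE7b is conditional on S1–S3, S6, (★) and LV5).
NE7b (`T4WeightBudget.RelWeightBound`) NOT PRINTED and NOT PROVED; spine PROVED 0∕9; rung (B)+1 on a FINITE torus T⁴ —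
NOT infinite volume, NOT the mass gap, NOT Clay. HONEST DEPENDENCY: continuum YM on T⁴ ⇐ BetaPertH ∧ nine spine
estimates (0/9 proved); BetaPertH ⇐ (D1) ∧ (D4) ∧ CAP+tail; G-an2-4 gates asym, D1 and NE2/3/4. POLICY: crux-route
work under `Spine/NE7b/`, not a `T4Continuum/Support` leaf (FREEZE (0) respected); 0 `def`, no `Prop`-valued fact,
no `[cite:]` fact.
-/

set_option autoImplicit false

namespace Summit.QuantumFields.BalabanUV.T4Continuum.NE7b.ScreeningGrowth

open Filter Topology

variable {E : ℕ → ℝ} {ε₀ Ca Cb : ℝ}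
  (h : 0 < ε₀ ∧ 0 < Ca ∧ 0 < Cb ∧ ε₀ ≤ E 0 ∧ ∀ k : ℕ,
    (E (k + 1) - E k ≤ ε₀ ∧ E k ≤ Ca * (E (k + 1) - E k)) ∨
    (ε₀ ≤ E (k + 1) - E k ∧ E k ≤ Cb * ((E (k + 1) - E k) / ε₀) ^ (3 / 4 : ℝ)))
include h

/-! ## §5 A double exponential beats every geometric sequence (explicitly), and S4's headline -/

omit h in
/-- Second-order Bernoulli bound for the ratio `4/3`: `1 + j/3 + j(j−1)/18 ≤ (4/3)^j`. -/
theorem quad_le_fourThirds_pow (j : ℕ) :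
    1 + (j : ℝ) / 3 + (j : ℝ) * ((j : ℝ) - 1) / 18 ≤ (4 / 3 : ℝ) ^ j := by
  induction j with
  | zero => norm_num
  | succ j ih =>
    have hj : (0 : ℝ) ≤ (j : ℝ) * ((j : ℝ) - 1) := by
      rcases Nat.eq_zero_or_pos j with rfl | hpos
      · simp
      · have : (1 : ℝ) ≤ j := by exact_mod_cast hpos
        nlinarith
    push_cast
    rw [pow_succ]
    nlinarith [ih, hj]

omit h in
/-- A double exponential beats a geometric sequence from an EXPLICIT index: for `c₀ > 0`, `L ≥ 1` and every
`j ≥ ⌈36·(log L + |log c₀| + 1)/log 2⌉₊ + 2`, `c₀ · L^j < 2^{(4/3)^j}`. -/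
theorem geometric_lt_dexp (c₀ L : ℝ) (hc : 0 < c₀) (hL : 1 ≤ L) (j : ℕ)
    (hj : ⌈36 * (Real.log L + |Real.log c₀| + 1) / Real.log 2⌉₊ + 2 ≤ j) :
    c₀ * L ^ j < (2 : ℝ) ^ ((4 / 3 : ℝ) ^ j) := by
  have hlog2 : 0 < Real.log 2 := Real.log_pos (by norm_num)
  have hlogL : 0 ≤ Real.log L := Real.log_nonneg hL
  set X := Real.log L + |Real.log c₀| + 1 with hX
  have hX0 : 0 < X := by positivity
  have hj2 : (2 : ℝ) ≤ j := by exact_mod_cast le_trans (Nat.le_add_left 2 _) hj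
  have hjX : 36 * X / Real.log 2 ≤ (j : ℝ) - 2 := by
    have h1 : 36 * X / Real.log 2 ≤ ⌈36 * X / Real.log 2⌉₊ := Nat.le_ceil _
    have h2 : (⌈36 * X / Real.log 2⌉₊ : ℝ) + 2 ≤ j := by exact_mod_cast hj
    linarith
  have hj36 : 36 * X ≤ (j : ℝ) * Real.log 2 := by
    rw [div_le_iff₀ hlog2] at hjX
    nlinarith
  have hLj : 0 < L ^ j := pow_pos (lt_of_lt_of_le one_pos hL) j
  have hlhs : Real.log (c₀ * L ^ j) = Real.log c₀ + j * Real.log L := by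
    rw [Real.log_mul hc.ne' hLj.ne', Real.log_pow]
  have hrhs : (2 : ℝ) ^ ((4 / 3 : ℝ) ^ j) = Real.exp (Real.log 2 * (4 / 3 : ℝ) ^ j) :=
    Real.rpow_def_of_pos (by norm_num) _
  rw [hrhs, ← Real.exp_log (by positivity : 0 < c₀ * L ^ j), Real.exp_lt_exp, hlhs]
  have hq := quad_le_fourThirds_pow j
  have hc0 : Real.log c₀ ≤ |Real.log c₀| := le_abs_self _
  have h1 : Real.log 2 * ((j : ℝ) * ((j : ℝ) - 1) / 18) ≤ Real.log 2 * (4 / 3 : ℝ) ^ j := by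
    apply mul_le_mul_of_nonneg_left _ hlog2.le
    have : 0 ≤ 1 + (j : ℝ) / 3 := by positivity
    linarith
  have h2 : Real.log 2 * ((j : ℝ) * ((j : ℝ) - 1) / 18) = ((j : ℝ) - 1) / 18 * ((j : ℝ) * Real.log 2) := by
    ring
  have h3 : ((j : ℝ) - 1) / 18 * (36 * X) ≤ ((j : ℝ) - 1) / 18 * ((j : ℝ) * Real.log 2) :=
    mul_le_mul_of_nonneg_left hj36 (by apply div_nonneg _ (by norm_num); linarith)
  have h4 : ((j : ℝ) - 1) / 18 * (36 * X) = 2 * ((j : ℝ) - 1) * X := by ring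
  have h5 : (j : ℝ) * X ≤ 2 * ((j : ℝ) - 1) * X := by nlinarith
  have h6 : (j : ℝ) * X = j * Real.log L + j * |Real.log c₀| + j := by rw [hX]; ring
  have h7 : |Real.log c₀| ≤ (j : ℝ) * |Real.log c₀| :=
    le_mul_of_one_le_left (abs_nonneg _) (by linarith)
  linarith

/-- S4's HEADLINE: `E` eventually exceeds EVERY geometric sequence — for all `A`, `Λ` there is `K` with
`A·Λ^k < E k` for every `k ≥ K` (`K = k₁ + J` with the explicit `k₁` of `dexp_lower_explicit` and the explicit `J` of
`geometric_lt_dexp` at `c₀ := (|A|+1)(|Λ|+1)^{k₁} ε₀³/Cb⁴`, `L := |Λ| + 1`). -/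
theorem eventually_gt_geometric (A Λ : ℝ) : ∃ K : ℕ, ∀ k : ℕ, K ≤ k → A * Λ ^ k < E k := by
  have hε := h.1
  have hCb := h.2.2.1
  set k₁ := ⌈Ca ^ 2⌉₊ + ⌈2 * Cb ^ 4 / ε₀ ^ 4⌉₊ with hk₁
  set M := |A| + 1 with hM1
  set L := |Λ| + 1 with hL1
  have hM : 0 < M := by positivity
  have hL : 1 ≤ L := by have := abs_nonneg Λ; linarith
  set c₀ := M * L ^ k₁ * ε₀ ^ 3 / Cb ^ 4 with hc₀1
  have hc₀ : 0 < c₀ := by positivity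
  set J := ⌈36 * (Real.log L + |Real.log c₀| + 1) / Real.log 2⌉₊ + 2 with hJ
  refine ⟨k₁ + J, fun k hk => ?_⟩
  obtain ⟨j, rfl⟩ : ∃ j, k = k₁ + j := ⟨k - k₁, by omega⟩
  have hj : J ≤ j := by omega
  have hlt := geometric_lt_dexp c₀ L hc₀ hL j hj
  have hdexp := dexp_lower_explicit h j
  have hAΛ : A * Λ ^ (k₁ + j) ≤ M * L ^ (k₁ + j) := by
    calc A * Λ ^ (k₁ + j) ≤ |A * Λ ^ (k₁ + j)| := le_abs_self _
      _ = |A| * |Λ| ^ (k₁ + j) := by rw [abs_mul, abs_pow]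
      _ ≤ M * L ^ (k₁ + j) := by
          apply mul_le_mul (by linarith [abs_nonneg A])
            (pow_le_pow_left₀ (abs_nonneg Λ) (by linarith [abs_nonneg Λ]) _) (by positivity) hM.le
  have hid : M * L ^ (k₁ + j) = Cb ^ 4 / ε₀ ^ 3 * (c₀ * L ^ j) := by
    rw [hc₀1, pow_add]
    field_simp
  rw [hid] at hAΛ
  have h2 : Cb ^ 4 / ε₀ ^ 3 * (c₀ * L ^ j) < Cb ^ 4 / ε₀ ^ 3 * (2 : ℝ) ^ ((4 / 3 : ℝ) ^ j) :=
    mul_lt_mul_of_pos_left hlt (by positivity)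
  linarith

/-! ## §6 The form corollary LV2⁺ consumes: `E k` beats `exp (a·θ^k)` for every `θ < 4/3` -/

/-- For `0 ≤ θ < 4/3` and every `a`, eventually `exp (a·θ^k) < E k`: the double exponential `2^{(4/3)^j}` has the
larger base of iteration. (Qualitative: the index comes from two limits, `(θ/(4/3))^j → 0` and `(4/3)^j → ∞`.) -/
theorem eventually_gt_exp_pow (a θ : ℝ) (hθ0 : 0 ≤ θ) (hθ : θ < 4 / 3) :
    ∃ K : ℕ, ∀ k : ℕ, K ≤ k → Real.exp (a * θ ^ k) < E k := by
  have hε := h.1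
  have hCb := h.2.2.1
  have hlog2 : 0 < Real.log 2 := Real.log_pos (by norm_num)
  set k₁ := ⌈Ca ^ 2⌉₊ + ⌈2 * Cb ^ 4 / ε₀ ^ 4⌉₊ with hk₁
  set D := Cb ^ 4 / ε₀ ^ 3 with hD1
  have hD : 0 < D := by positivity
  set ρ := θ / (4 / 3) with hρ1
  have hρ0 : 0 ≤ ρ := by positivity
  have hρ : ρ < 1 := by rw [hρ1, div_lt_one (by norm_num)]; exact hθ
  -- the two limits
  have hlim1 : Tendsto (fun j : ℕ => |a| * θ ^ k₁ * ρ ^ j) atTop (𝓝 0) := by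
    have := (tendsto_pow_atTop_nhds_zero_of_lt_one hρ0 hρ).const_mul (|a| * θ ^ k₁)
    simpa using this
  have hlim2 : Tendsto (fun j : ℕ => (4 / 3 : ℝ) ^ j) atTop atTop :=
    tendsto_pow_atTop_atTop_of_one_lt (by norm_num)
  have hev1 : ∀ᶠ j : ℕ in atTop, |a| * θ ^ k₁ * ρ ^ j < Real.log 2 / 2 :=
    (tendsto_order.1 hlim1).2 _ (by positivity)
  have hev2 : ∀ᶠ j : ℕ in atTop, 2 * (|Real.log D| + 1) / Real.log 2 < (4 / 3 : ℝ) ^ j :=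
    hlim2.eventually_gt_atTop _
  obtain ⟨J, hJ⟩ := eventually_atTop.1 (hev1.and hev2)
  refine ⟨k₁ + J, fun k hk => ?_⟩
  obtain ⟨j, rfl⟩ : ∃ j, k = k₁ + j := ⟨k - k₁, by omega⟩
  obtain ⟨hj1, hj2⟩ := hJ j (by omega)
  have hdexp := dexp_lower_explicit h j
  have h43 : (0 : ℝ) < (4 / 3 : ℝ) ^ j := pow_pos (by norm_num) j
  -- a θ^(k₁+j) ≤ |a| θ^k₁ ρ^j (4/3)^j ≤ (log 2 / 2) (4/3)^j
  have hθj : θ ^ j = ρ ^ j * (4 / 3 : ℝ) ^ j := by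
    rw [← mul_pow, hρ1, div_mul_cancel₀ θ (by norm_num : (4 / 3 : ℝ) ≠ 0)]
  have ha1 : a * θ ^ (k₁ + j) ≤ |a| * θ ^ k₁ * ρ ^ j * (4 / 3 : ℝ) ^ j := by
    rw [pow_add, hθj]
    have : a * (θ ^ k₁ * (ρ ^ j * (4 / 3 : ℝ) ^ j)) ≤ |a| * (θ ^ k₁ * (ρ ^ j * (4 / 3 : ℝ) ^ j)) :=
      mul_le_mul_of_nonneg_right (le_abs_self a) (by positivity)
    linarith
  have ha2 : |a| * θ ^ k₁ * ρ ^ j * (4 / 3 : ℝ) ^ j ≤ Real.log 2 / 2 * (4 / 3 : ℝ) ^ j :=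
    mul_le_mul_of_nonneg_right hj1.le h43.le
  -- D · 2^{(4/3)^j} = exp (log D + log 2 · (4/3)^j)
  have hE : Real.exp (Real.log D + Real.log 2 * (4 / 3 : ℝ) ^ j) = D * (2 : ℝ) ^ ((4 / 3 : ℝ) ^ j) := by
    rw [Real.exp_add, Real.exp_log hD, Real.rpow_def_of_pos (by norm_num : (0 : ℝ) < 2)]
  have hlogD : -(|Real.log D| + 1) < Real.log D := by
    have := neg_abs_le (Real.log D); linarith
  have hmid : 2 * (|Real.log D| + 1) < Real.log 2 * (4 / 3 : ℝ) ^ j := by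
    have := (div_lt_iff₀ hlog2).1 hj2
    linarith
  have hexp : Real.exp (a * θ ^ (k₁ + j)) < Real.exp (Real.log D + Real.log 2 * (4 / 3 : ℝ) ^ j) := by
    rw [Real.exp_lt_exp]
    linarith
  calc Real.exp (a * θ ^ (k₁ + j)) < D * (2 : ℝ) ^ ((4 / 3 : ℝ) ^ j) := by rw [← hE]; exact hexp
    _ ≤ E (k₁ + j) := hdexp

omit h in
/-- `4^{1/5} < 4/3` (since `(4/3)^5 = 1024/243 > 4`): the base `θ = 4^{1/5}` of LV2⁺'s comparison sequence
`exp((4^k r₀)^{1/5}) = exp(r₀^{1/5}·(4^{1/5})^k)` qualifies for `eventually_gt_exp_pow`. -/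
theorem four_rpow_fifth_lt : (4 : ℝ) ^ (1 / 5 : ℝ) < 4 / 3 := by
  have h1 : (4 : ℝ) < (4 / 3 : ℝ) ^ (5 : ℕ) := by norm_num
  have h2 : (4 : ℝ) ^ (1 / 5 : ℝ) < ((4 / 3 : ℝ) ^ (5 : ℕ)) ^ (1 / 5 : ℝ) :=
    Real.rpow_lt_rpow (by norm_num) h1 (by norm_num)
  have h3 : ((4 / 3 : ℝ) ^ (5 : ℕ)) ^ (1 / 5 : ℝ) = 4 / 3 := by
    rw [← Real.rpow_natCast, ← Real.rpow_mul (by norm_num : (0 : ℝ) ≤ 4 / 3)]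
    norm_num
  rw [h3] at h2
  exact h2

/-- LV2⁺'s comparison along the radii `R = 4^k·r₀` (`r₀ ≥ 0`): eventually `exp ((4^k·r₀)^{1/5}) < E k`. -/
theorem eventually_gt_exp_radius_fifth (r₀ : ℝ) (hr : 0 ≤ r₀) :
    ∃ K : ℕ, ∀ k : ℕ, K ≤ k → Real.exp (((4 : ℝ) ^ k * r₀) ^ (1 / 5 : ℝ)) < E k := by
  obtain ⟨K, hK⟩ := eventually_gt_exp_pow h (r₀ ^ (1 / 5 : ℝ)) ((4 : ℝ) ^ (1 / 5 : ℝ))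
    (Real.rpow_nonneg (by norm_num) _) four_rpow_fifth_lt
  refine ⟨K, fun k hk => ?_⟩
  have hid : ((4 : ℝ) ^ k * r₀) ^ (1 / 5 : ℝ) = r₀ ^ (1 / 5 : ℝ) * ((4 : ℝ) ^ (1 / 5 : ℝ)) ^ k := by
    rw [Real.mul_rpow (by positivity) hr, ← Real.rpow_natCast (4 : ℝ) k,
      ← Real.rpow_mul (by norm_num : (0 : ℝ) ≤ 4), mul_comm (k : ℝ), Real.rpow_mul_natCast (by norm_num : (0 : ℝ) ≤ 4)]
    ring
  rw [hid]
  exact hK k hk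


end Summit.QuantumFields.BalabanUV.T4Continuum.NE7b.ScreeningGrowth
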